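import Summits.SmoothPoincare4.SmoothPoincare4.Theses.SymplecticOrigami
import Literature.Topology.FourManifolds.HomotopySpheres
import Literature.Topology.FourManifolds.Diffeotopy

/-!
# Birth skeleton of piece X₁ `HostEmbedding` (split of crux `OrigamiFoldExistence`, stmt-SmoothPoincare4-7844)

X₁ = the fake ball `Δ_e = S ∖ e(B̊⁴)` of every homotopy 4-sphere `S` embeds (a neighbourhood of it,
smoothly) in a CLOSED SIMPLY CONNECTED symplectic `ℝ⁴`-charted `(X, Ω)` carrying an `Ω`-symplectic
embedded 2-sphere `c` with a disjoint homotopic push-off `c'` ("rational host": square zero ⇒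
rational/ruled by McDuff 1990; simply connected ⇒ rational).  Verbatim the registered
`stub_hostEmbedding` of line `stable-seam-host`.

PLAN (two stubs, both genuine, neither the piece):
* `stub_sphereProdDissolution` [smooth 4- and 5-dimensional topology; OPEN; the research half] — the fake
  ball of every homotopy 4-sphere embeds in a closed simply connected `ℝ⁴`-charted 4-manifold
  DIFFEOMORPHIC TO `S² × S²` (Mathlib's product sphere, model `(𝓡 2).prod (𝓡 2)`, exactly as route
  `Stabilisation` types it).  Implied by `Stabilisation.StabOneSuffices` (stmt-SmoothPoincare4-0386:
  `Σ # (S²×S²) ≅ S²×S²` puts `Σ ∖ B̊⁴ ⊂ Σ # (S²×S²)` inside `S²×S²`; Wall 1964 gives `#k`, `k = 1` is the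
  open point) and strictly weaker (it only asks `Σ # Q'' ≅ S²×S²` for SOME homotopy `S²×S²` `Q'' = B⁴ ∪ C`);
  known for `S⁴` and for every Gluck twist (dissolve in `S²×S²` or `S²×̃S²`; Akbulut–Yasui 2013 Cor 1.3,
  Kasprowski–Powell–Ray 2023 L.3.1).  Why it might fail: a homotopy sphere needing two `S²×S²`
  summands (Kang's territory, barrier A13) — unprovable rather than false short of that.
* `stub_sphereProdSymplecticHost` [KNOWN theorem, formal debt L–XL, riskless] — every closed
  `ℝ⁴`-charted 4-manifold diffeomorphic to `S² × S²` carries a symplectic `MForm` with a square-zero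
  symplectic sphere pair: pull back the tree's PROVED product form
  `Literature.Geometry.Symplectic.sphereProdForm` (`sphereProdForm_isSymplectic`; McDuff–Salamon 2017
  Ex. 10.4.2(iii)) along the diffeomorphism and transport the proved symplectic slices
  `horizSlice q`, `horizSlice q'` (`sphereProdForm_horizSlice_nondegenerate`, `disjoint_range_horizSlice`,
  `homotopic_horizSlice`).  Lead c8 (CALIBRATION-c8 §6) names exactly this as "the XL-but-riskless
  support item the planner may file; STUB 1 ⇐ StabOneSuffices ∧ it".
* Composition `HostEmbedding_of` — pure logic (host from stub 1, structure from stub 2).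

BC3 probes (bc/HostEmbedding_birth_probe.lean): each stub ↛ X₁, each stub ↛ SmoothPoincare4 under
`exact? | aesop` (must fail: stub 1 has no form, stub 2 no embedding).
-/

noncomputable section

-- the prescribed namespace `Summit.<P>.<Sub>.…` duplicates `SmoothPoincare4` (P = Sub)
set_option linter.dupNamespace false

open scoped Manifold ContDiff Topology RealInnerProductSpace
open Set Function TopologicalSpace ContinuousMap

/-! ### The piece(s), declared LOCALLY in the route namespace exactly as the gate will render them
after `route edit --split` (pre-split draft; the published version imports the route file instead) -/

namespace Summit.SmoothPoincare4.SmoothPoincare4.Theses.SymplecticOrigami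

/-- piece HostEmbedding (= registered `stub_hostEmbedding` of line stable-seam-host, verbatim). -/
def HostEmbedding : Prop :=
  ∀ (S : Literature.Topology.FourManifolds.HomotopySphere 4) (e : EuclideanSpace ℝ (Fin 4) → S.carrier), Manifold.IsSmoothEmbedding (𝓡 4) (𝓡 4) ∞ e → ∃ (X : Type) (_ : TopologicalSpace X) (_ : T2Space X) (_ : SecondCountableTopology X) (_ : CompactSpace X) (_ : ChartedSpace (EuclideanSpace ℝ (Fin 4)) X) (_ : IsManifold (𝓡 4) ∞ X) (_ : SimplyConnectedSpace X) (Ω : Literature.Geometry.Kaehler.MForm (𝓡 4) X ℝ 2) (J : S.carrier → X) (c c' : (Metric.sphere (0 : EuclideanSpace ℝ (Fin 3)) 1) → X), (Literature.Geometry.Kaehler.IsSmoothForm Ω ∧ Literature.Geometry.Kaehler.IsClosedForm Ω ∧ ∀ x (v : TangentSpace (𝓡 4) x), v ≠ 0 → ∃ w, Ω x ![v, w] ≠ 0) ∧ (∃ U : Set S.carrier, IsOpen U ∧ (e '' Metric.ball (0 : EuclideanSpace ℝ (Fin 4)) 1)ᶜ ⊆ U ∧ ContMDiffOn (𝓡 4)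 (𝓡 4) ∞ J U ∧ Set.InjOn J U ∧ ∀ x ∈ U, Function.Bijective (mfderiv (𝓡 4) (𝓡 4) J x)) ∧ (Manifold.IsSmoothEmbedding (𝓡 2) (𝓡 4) ∞ c ∧ (∀ y (v : TangentSpace (𝓡 2) y), v ≠ 0 → ∃ w : TangentSpace (𝓡 2) y, Ω (c y) ![mfderiv (𝓡 2) (𝓡 4) c y v, mfderiv (𝓡 2) (𝓡 4) c y w] ≠ 0) ∧ Manifold.IsSmoothEmbedding (𝓡 2) (𝓡 4) ∞ c' ∧ Disjoint (Set.range c) (Set.range c') ∧ ∃ H : unitInterval × (Metric.sphere (0 : EuclideanSpace ℝ (Fin 3)) 1) → X, Continuous H ∧ ∀ y, H (0, y) = c y ∧ H (1, y) = c' y)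

end Summit.SmoothPoincare4.SmoothPoincare4.Theses.SymplecticOrigami

namespace Summit.SmoothPoincare4.SmoothPoincare4.Cruxes.HostEmbedding.Birth

open Summit.SmoothPoincare4.SmoothPoincare4.Theses.SymplecticOrigami (HostEmbedding)

/-- Statement of stub 1 [dissolution of the fake ball in `S² × S²`]. -/
def SphereProdDissolution : Prop :=
  ∀ (S : Literature.Topology.FourManifolds.HomotopySphere 4) (e : EuclideanSpace ℝ (Fin 4) → S.carrier), Manifold.IsSmoothEmbedding (𝓡 4) (𝓡 4) ∞ e → ∃ (X : Type) (_ : TopologicalSpace X) (_ : T2Space X) (_ : SecondCountableTopology X) (_ : CompactSpace X) (_ : ChartedSpace (EuclideanSpace ℝ (Fin 4)) X) (_ : IsManifold (𝓡 4) ∞ X) (_ : SimplyConnectedSpace X) (J : S.carrier → X), (∃ U : Set S.carrier, IsOpen U ∧ (e '' Metric.ball (0 : EuclideanSpace ℝ (Fin 4)) 1)ᶜ ⊆ U ∧ ContMDiffOn (𝓡 4) (𝓡 4) ∞ J U ∧ Set.InjOn J U ∧ ∀ x ∈ U, Function.Bijective (mfderiv (𝓡 4) (𝓡 4) J x)) ∧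 Nonempty (X ≃ₘ⟮𝓡 4, (𝓡 2).prod (𝓡 2)⟯ ((Metric.sphere (0 : EuclideanSpace ℝ (Fin 3)) 1) × (Metric.sphere (0 : EuclideanSpace ℝ (Fin 3)) 1)))

/-- Statement of stub 2 [a copy of `S² × S²` is a rational symplectic host]. -/
def SphereProdSymplecticHost : Prop :=
  ∀ (X : Type) [TopologicalSpace X] [T2Space X] [SecondCountableTopology X] [CompactSpace X] [ChartedSpace (EuclideanSpace ℝ (Fin 4)) X] [IsManifold (𝓡 4) ∞ X], Nonempty (X ≃ₘ⟮𝓡 4, (𝓡 2).prod (𝓡 2)⟯ ((Metric.sphere (0 : EuclideanSpace ℝ (Fin 3)) 1) × (Metric.sphere (0 : EuclideanSpace ℝ (Fin 3)) 1))) → ∃ (Ω : Literature.Geometry.Kaehler.MForm (𝓡 4) X ℝ 2) (c c' : (Metric.sphere (0 : EuclideanSpace ℝ (Fin 3)) 1) → X), (Literature.Geometry.Kaehler.IsSmoothForm Ω ∧ Literature.Geometry.Kaehler.IsClosedForm Ω ∧ ∀ x (v : TangentSpace (𝓡 4) x), v ≠ 0 → ∃ w, Ω x ![v, w] ≠ 0)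 ∧ (Manifold.IsSmoothEmbedding (𝓡 2) (𝓡 4) ∞ c ∧ (∀ y (v : TangentSpace (𝓡 2) y), v ≠ 0 → ∃ w : TangentSpace (𝓡 2) y, Ω (c y) ![mfderiv (𝓡 2) (𝓡 4) c y v, mfderiv (𝓡 2) (𝓡 4) c y w] ≠ 0) ∧ Manifold.IsSmoothEmbedding (𝓡 2) (𝓡 4) ∞ c' ∧ Disjoint (Set.range c) (Set.range c') ∧ ∃ H : unitInterval × (Metric.sphere (0 : EuclideanSpace ℝ (Fin 3)) 1) → X, Continuous H ∧ ∀ y, H (0, y) = c y ∧ H (1, y) = c' y)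

/-- STUB 1 [SPHERE-PRODUCT DISSOLUTION OF THE FAKE BALL] (open; smooth topology).  For every
homotopy 4-sphere `S` and chart ball `e`, a neighbourhood of the fake ball `Δ_e = S ∖ e(B̊⁴)` embeds
smoothly (`J` injective, immersive, `C^∞` on an open `U ⊇ Δ_e`) into a closed simply connected
`ℝ⁴`-charted 4-manifold `X` diffeomorphic to `S² × S²`.  ⇐ `Stabilisation.StabOneSuffices`
(stmt-0386) and strictly weaker; known for `S⁴` and all Gluck twists.  Why it might fail: a
homotopy sphere that dissolves only after two stabilisations (A13, Kang) — unprovable, not false,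
short of that.  Sources: Wall1964, AkbulutYasui2013, KasprowskiPowellRay2023, Gompf1991,
FreedmanQuinn1990. -/
theorem stub_sphereProdDissolution :
    ∀ (S : Literature.Topology.FourManifolds.HomotopySphere 4) (e : EuclideanSpace ℝ (Fin 4) → S.carrier), Manifold.IsSmoothEmbedding (𝓡 4) (𝓡 4) ∞ e → ∃ (X : Type) (_ : TopologicalSpace X) (_ : T2Space X) (_ : SecondCountableTopology X) (_ : CompactSpace X) (_ : ChartedSpace (EuclideanSpace ℝ (Fin 4)) X) (_ : IsManifold (𝓡 4) ∞ X) (_ : SimplyConnectedSpace X) (J : S.carrier → X), (∃ U : Set S.carrier, IsOpen U ∧ (e '' Metric.ball (0 : EuclideanSpace ℝ (Fin 4)) 1)ᶜ ⊆ U ∧ ContMDiffOn (𝓡 4) (𝓡 4) ∞ J U ∧ Set.InjOn J U ∧ ∀ x ∈ U, Function.Bijective (mfderiv (𝓡 4) (𝓡 4) J x)) ∧ Nonempty (X ≃ₘ⟮𝓡 4, (𝓡 2).prod (𝓡 2)⟯ ((Metric.sphere (0 : EuclideanSpace ℝ (Fin 3)) 1) × (Metric.sphere (0 : EuclideanSpace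 ℝ (Fin 3)) 1))) := by
  sorry

/-- STUB 2 [`S² × S²` IS A RATIONAL SYMPLECTIC HOST] (known theorem; formal debt, riskless).  Every
closed `ℝ⁴`-charted 4-manifold `X` diffeomorphic to Mathlib's `S² × S²` carries a chartwise
smooth, closed, nondegenerate `MForm` `Ω` and an `Ω`-symplectic embedded 2-sphere `c` with a
disjoint homotopic embedded push-off `c'`: pull back the PROVED product form
`Literature.Geometry.Symplectic.sphereProdForm` (`sphereProdForm_isSymplectic`) along the
diffeomorphism (tree `MForm.pullback` calculus) and transport the PROVED symplectic horizontal
slices `horizSlice q ≠ horizSlice q'` (`isSmoothEmbedding_horizSlice`,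
`sphereProdForm_horizSlice_nondegenerate`, `disjoint_range_horizSlice`, `homotopic_horizSlice`).
Sources: McDuffSalamon2017 (§3.1, Ex. 10.4.2(iii)), McDuff1990. -/
theorem stub_sphereProdSymplecticHost :
    ∀ (X : Type) [TopologicalSpace X] [T2Space X] [SecondCountableTopology X] [CompactSpace X] [ChartedSpace (EuclideanSpace ℝ (Fin 4)) X] [IsManifold (𝓡 4) ∞ X], Nonempty (X ≃ₘ⟮𝓡 4, (𝓡 2).prod (𝓡 2)⟯ ((Metric.sphere (0 : EuclideanSpace ℝ (Fin 3)) 1) × (Metric.sphere (0 : EuclideanSpace ℝ (Fin 3)) 1))) → ∃ (Ω : Literature.Geometry.Kaehler.MForm (𝓡 4) X ℝ 2) (c c' : (Metric.sphere (0 : EuclideanSpace ℝ (Fin 3)) 1) → X), (Literature.Geometry.Kaehler.IsSmoothForm Ω ∧ Literature.Geometry.Kaehler.IsClosedForm Ω ∧ ∀ x (v : TangentSpace (𝓡 4) x), v ≠ 0 → ∃ w, Ω x ![v, w] ≠ 0) ∧ (Manifold.IsSmoothEmbedding (𝓡 2) (𝓡 4) ∞ c ∧ (∀ y (v : TangentSpace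 (𝓡 2) y), v ≠ 0 → ∃ w : TangentSpace (𝓡 2) y, Ω (c y) ![mfderiv (𝓡 2) (𝓡 4) c y v, mfderiv (𝓡 2) (𝓡 4) c y w] ≠ 0) ∧ Manifold.IsSmoothEmbedding (𝓡 2) (𝓡 4) ∞ c' ∧ Disjoint (Set.range c) (Set.range c') ∧ ∃ H : unitInterval × (Metric.sphere (0 : EuclideanSpace ℝ (Fin 3)) 1) → X, Continuous H ∧ ∀ y, H (0, y) = c y ∧ H (1, y) = c' y) := by
  sorry

/-! ### Consistency: the named statements ARE the stubs -/

theorem sphereProdDissolution_holds : SphereProdDissolution := stub_sphereProdDissolution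
theorem sphereProdSymplecticHost_holds : SphereProdSymplecticHost := stub_sphereProdSymplecticHost

/-! ### Composition (pure logic, no `sorry`) -/

/-- `HostEmbedding` from the two stubs, BY NAME: the host and the embedding from stub 1, the
symplectic form and the uniruledness witness from stub 2. -/
theorem HostEmbedding_of (h1 : SphereProdDissolution) (h2 : SphereProdSymplecticHost) :
    HostEmbedding := by
  intro S e he
  obtain ⟨X, i1, i2, i3, i4, i5, i6, i7, J, hJ, hd⟩ := h1 S e he
  obtain ⟨Ω, c, c', hΩ, hc⟩ := @h2 X i1 i2 i3 i4 i5 i6 hd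
  exact ⟨X, i1, i2, i3, i4, i5, i6, i7, Ω, J, c, c', hΩ, hJ, hc⟩

/-- Wiring check. -/
example : HostEmbedding := HostEmbedding_of stub_sphereProdDissolution stub_sphereProdSymplecticHost

end Summit.SmoothPoincare4.SmoothPoincare4.Cruxes.HostEmbedding.Birth

end
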